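import Mathlib
import HarnessLib
import Summits.Ventures.LatticeQCDFlow.Scaling.AutoregressiveGaugeMixingProfile
import Summits.Ventures.LatticeQCDFlow.Scaling.AutoregressiveGaugeColdEscapeRatio
import Summits.Ventures.LatticeQCDFlow.Scaling.AutoregressiveGaugeColdEscapeDimension

/-!
# LatticeQCDFlow / Scaling — mixing dominance: the all-closing conditioner along the induced assignment is
# `ε`-mixed (worst case, total variation) whenever the one-plaquette heat bath is, and strictly earlier

HONEST FRAMING: exact (Metropolis-corrected) sampling algorithms for lattice gauge theory;
figures of merit are autocorrelation/cost numbers at stated couplings and volumes; no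
continuum-physics claim.

Venture `LatticeQCDFlow` (cell pub-lqcd), topic `Scaling`, FANOUT row 30 (lean-1, GEN-28) — OUR WORK on
THEORY-2.md §4 row C5.  `AutoregressiveGaugeMixingProfile` computed the exact worst-case profiles of the two exact
samplers (`(1 − A(cold))^t`, with `A_hb(cold) = Z/(c^{#B} M^k)` for the one-plaquette heat bath on a ranked
structure `(B, t, rank)` and `A_all(cold) = Z/∏_{ℓ∈T} c_{#C_ℓ}` for the all-closing conditioner), and
`AutoregressiveGaugeColdEscapeRatio` the exact ratio `A_hb(cold) = η · A_all(cold)` along the INDUCED assignment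
(`T = t(B)`, `C_{t(a)} = {a} ∪ u⁻¹(a)` for a total closing map `u : Bᶜ → B`).  Here the two are combined:

* `heatBath_coldRate_le_induced_allClosing` / `heatBath_coldRate_lt_induced_allClosing` — the rate comparison
  `Z/(c^{#B} M^k) ≤ Z/∏_{a∈B} c_{n_a+1}` (every factor `θ_{n_a} ≤ 1`), STRICT as soon as `Z > 0`, `w` is not
  constant and some covered plaquette closes an uncovered one;
* **`allClosing_mixed_of_heatBath_mixed`** — for every time `t` and every `ε`: if every start and event of the
  heat bath are `ε`-close to `π` at time `t`, so are every start and event of the induced all-closing sampler;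
* **`exists_allClosing_mixed_heatBath_not`** — conversely, at every time `t ≥ 1` there is an `ε` (namely
  `(1 − A_all(cold))^t`) at which the all-closing sampler is `ε`-mixed from every start but the heat bath is not
  (`w` non-constant, a closer present): the worst-case mixing profile of the all-closing conditioner lies
  STRICTLY below the heat bath's at every positive time.

NOT CLAIMED: a comparison from a common warm start (both profiles are worst-case = cold-start statements), or
any statement about cost per step (the all-closing proposal conditions on more plaquettes per link).
No `def`, no `sorry`, nothing cited as a fact beyond the tree.
-/

noncomputable section

namespace Summit.Ventures.LatticeQCDFlow.Theory2.Autoregressive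

open MeasureTheory ProbabilityTheory Function Finset Summit.Ventures.LatticeQCDFlow.Exactness
open Literature.MathematicalPhysics.QuantumFieldTheory Literature.MathematicalPhysics.QuantumLattice
open scoped ENNReal

variable {d L : ℕ} [NeZero L] {G : Type*} [Group G] [TopologicalSpace G] [IsTopologicalGroup G]
  [CompactSpace G] [SecondCountableTopology G] [MeasurableSpace G] [BorelSpace G]

omit [SecondCountableTopology G] in
/-- **Rate comparison**: `Z/(c^{#B} M^k) ≤ Z/∏_{ℓ∈t(B)} c_{#C_ℓ}` along the induced assignment (`Z ≥ 0`; every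
factor of `η` is `≤ 1`). [ours] -/
theorem heatBath_coldRate_le_induced_allClosing {w : G → ℝ} (hw : Continuous w)
    (hw0 : ∀ g, 0 < w g) {M : ℝ} (hM : ∀ g, w g ≤ M) (B : Finset (Plaquette d L))
    (t : Plaquette d L → Edge d L) (hinj : Set.InjOn t B) (u : Plaquette d L → Plaquette d L)
    (huB : ∀ p' ∈ Finset.univ \ B, u p' ∈ B) {Z : ℝ} (hZ : 0 ≤ Z) :
    Z / ((∫ g, w g ∂(haarProbability G)) ^ B.card * M ^ (Finset.univ \ B).card) ≤
      Z / ∏ ℓ ∈ B.image t, ∫ h, w h ^ (B.filter (fun b => t b = ℓ) ∪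
        (Finset.univ \ B).filter (fun p' => t (u p') = ℓ)).card ∂(haarProbability G) := by
  classical
  have hc : 0 < ∫ g, w g ∂(haarProbability G) := haarProbability_integral_pos_of_continuous_pos hw hw0
  have hMpos : 0 < M := (hw0 1).trans_le (hM 1)
  have hcst : ∀ j : ℕ, 0 < ∫ h, w h ^ j ∂(haarProbability G) := fun j =>
    haarProbability_integral_pos_of_continuous_pos (hw.pow j) fun h => pow_pos (hw0 h) j
  rw [prod_induced_eq B t u hinj huB (fun j => ∫ h, w h ^ j ∂(haarProbability G)),
    heatBath_coldRate_eq_eta_mul hc hMpos (fun j => ∫ h, w h ^ j ∂(haarProbability G)) hcst B u huB]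
  refine mul_le_of_le_one_left (div_nonneg hZ (prod_nonneg fun a _ => (hcst _).le)) ?_
  exact Finset.prod_le_one (fun a _ => div_nonneg (hcst _).le (mul_pos hc (pow_pos hMpos _)).le)
    fun a _ => ratio_le_one hw hw0 hM _

omit [SecondCountableTopology G] in
/-- **Strict rate comparison**: `Z/(c^{#B} M^k) < Z/∏_{ℓ∈t(B)} c_{#C_ℓ}` as soon as `Z > 0`, `w` is not constant
and some covered plaquette closes an uncovered one (`η < 1`, `eta_lt_one`). [ours] -/
theorem heatBath_coldRate_lt_induced_allClosing {w : G → ℝ} (hw : Continuous w)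
    (hw0 : ∀ g, 0 < w g) {M : ℝ} (hM : ∀ g, w g ≤ M) {g₀ : G} (hg₀ : w g₀ < M) (B : Finset (Plaquette d L))
    (t : Plaquette d L → Edge d L) (hinj : Set.InjOn t B) (u : Plaquette d L → Plaquette d L)
    (huB : ∀ p' ∈ Finset.univ \ B, u p' ∈ B) {a₀ : Plaquette d L} (ha₀ : a₀ ∈ B)
    (hn : 1 ≤ ((Finset.univ \ B).filter (fun p' => u p' = a₀)).card) {Z : ℝ} (hZ : 0 < Z) :
    Z / ((∫ g, w g ∂(haarProbability G)) ^ B.card * M ^ (Finset.univ \ B).card) <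
      Z / ∏ ℓ ∈ B.image t, ∫ h, w h ^ (B.filter (fun b => t b = ℓ) ∪
        (Finset.univ \ B).filter (fun p' => t (u p') = ℓ)).card ∂(haarProbability G) := by
  classical
  have hc : 0 < ∫ g, w g ∂(haarProbability G) := haarProbability_integral_pos_of_continuous_pos hw hw0
  have hMpos : 0 < M := (hw0 1).trans_le (hM 1)
  have hcst : ∀ j : ℕ, 0 < ∫ h, w h ^ j ∂(haarProbability G) := fun j =>
    haarProbability_integral_pos_of_continuous_pos (hw.pow j) fun h => pow_pos (hw0 h) j
  rw [prod_induced_eq B t u hinj huB (fun j => ∫ h, w h ^ j ∂(haarProbability G)),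
    heatBath_coldRate_eq_eta_mul hc hMpos (fun j => ∫ h, w h ^ j ∂(haarProbability G)) hcst B u huB]
  exact mul_lt_of_lt_one_left (div_pos hZ (prod_pos fun a _ => hcst _)) (eta_lt_one hw hw0 hM hg₀ B u ha₀ hn)

/-- **MIXING DOMINANCE.**  `L ≥ 2`, `d ≥ 1`, Haar without atoms; `w` continuous, `0 < m ≤ w ≤ M = w(1)`,
`w(g⁻¹) = w(g)`; `(B, t, rank)` ranked with a total closing map `u : Bᶜ → B` (`t(u p')` a link of `p'`); `π` the
plaquette-weight target, `q_B` the one-plaquette heat-bath proposal, `q` the all-closing proposal along the induced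
assignment.  If at time `t` every start and event of the heat bath are `ε`-close to `π`, then so are every start
and event of the all-closing sampler. [ours] -/
theorem allClosing_mixed_of_heatBath_mixed [MeasurableSingletonClass G] [NullSingletonClass (haarProbability G)]
    (hd : 0 < d) (hL : 2 ≤ L) {w : G → ℝ} (hw : Continuous w) {m M : ℝ} (hm0 : 0 < m)
    (hm : ∀ g, m ≤ w g) (hM : ∀ g, w g ≤ M) (hw1 : w 1 = M) (hwinv : ∀ g, w g⁻¹ = w g)
    (B : Finset (Plaquette d L)) (t : Plaquette d L → Edge d L)
    (ht : ∀ p ∈ B, t p ∈ ({(p.1, p.2.1.1), (p.1.shift p.2.1.1, p.2.1.2),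
        (p.1.shift p.2.1.2, p.2.1.1), (p.1, p.2.1.2)} : Finset (Edge d L)))
    (rank : Plaquette d L → ℕ)
    (hrank : ∀ p ∈ B, ∀ p' ∈ B, p ≠ p' → t p ∈ ({(p'.1, p'.2.1.1), (p'.1.shift p'.2.1.1, p'.2.1.2),
        (p'.1.shift p'.2.1.2, p'.2.1.1), (p'.1, p'.2.1.2)} : Finset (Edge d L)) → rank p < rank p')
    (u : Plaquette d L → Plaquette d L) (huB : ∀ p' ∈ Finset.univ \ B, u p' ∈ B)
    (hut : ∀ p' ∈ Finset.univ \ B, t (u p') ∈ ({(p'.1, p'.2.1.1), (p'.1.shift p'.2.1.1, p'.2.1.2),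
        (p'.1.shift p'.2.1.2, p'.2.1.1), (p'.1, p'.2.1.2)} : Finset (Edge d L)))
    (π qB q : Measure (GaugeConfig d L G)) [IsProbabilityMeasure π] [IsProbabilityMeasure qB]
    [IsProbabilityMeasure q]
    (hπ : π = (Measure.pi fun _ : Edge d L => haarProbability G).withDensity fun U =>
      ENNReal.ofReal ((∏ p : Plaquette d L, w (plaquetteHolonomy U p.1 p.2.1.1 p.2.1.2)) /
        ∫ V, ∏ p : Plaquette d L, w (plaquetteHolonomy V p.1 p.2.1.1 p.2.1.2) ∂(Measure.pi fun _ : Edge d L => haarProbability G)))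
    (hqB : qB = (Measure.pi fun _ : Edge d L => haarProbability G).withDensity fun U =>
      ENNReal.ofReal ((∏ p ∈ B, w (plaquetteHolonomy U p.1 p.2.1.1 p.2.1.2)) /
        ∫ V, ∏ p ∈ B, w (plaquetteHolonomy V p.1 p.2.1.1 p.2.1.2) ∂(Measure.pi fun _ : Edge d L => haarProbability G)))
    (hq : q = (Measure.pi fun _ : Edge d L => haarProbability G).withDensity fun U =>
      ENNReal.ofReal (∏ ℓ ∈ B.image t,
        (∏ p ∈ B.filter (fun b => t b = ℓ) ∪ (Finset.univ \ B).filter (fun p' => t (u p') = ℓ),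
            w (plaquetteHolonomy U p.1 p.2.1.1 p.2.1.2)) /
          (∫ v, ∏ p ∈ B.filter (fun b => t b = ℓ) ∪ (Finset.univ \ B).filter (fun p' => t (u p') = ℓ),
            w (plaquetteHolonomy (update U ℓ v) p.1 p.2.1.1 p.2.1.2) ∂(haarProbability G))))
    (n : ℕ) (ε : ℝ)
    (h : ∀ (μ : Measure (GaugeConfig d L G)) [IsProbabilityMeasure μ] (A : Set (GaugeConfig d L G)),
      |((fun ν : Measure (GaugeConfig d L G) => ν.bind (indepMH qB fun U =>
        ((∫ V, ∏ p : Plaquette d L, w (plaquetteHolonomy V p.1 p.2.1.1 p.2.1.2)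
            ∂(Measure.pi fun _ : Edge d L => haarProbability G)) /
          ((∫ V, ∏ p ∈ B, w (plaquetteHolonomy V p.1 p.2.1.1 p.2.1.2)
            ∂(Measure.pi fun _ : Edge d L => haarProbability G)) *
            ∏ p ∈ Finset.univ \ B, w (plaquetteHolonomy U p.1 p.2.1.1 p.2.1.2)))⁻¹))^[n] μ).real A -
        π.real A| ≤ ε) :
    ∀ (μ : Measure (GaugeConfig d L G)) [IsProbabilityMeasure μ] (A : Set (GaugeConfig d L G)),
      |((fun ν : Measure (GaugeConfig d L G) => ν.bind (indepMH q fun U =>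
        (((∫ V, ∏ p : Plaquette d L, w (plaquetteHolonomy V p.1 p.2.1.1 p.2.1.2) ∂(Measure.pi fun _ : Edge d L => haarProbability G)) /
          ∏ ℓ ∈ B.image t, (∫ v, ∏ p ∈ B.filter (fun b => t b = ℓ) ∪ (Finset.univ \ B).filter (fun p' => t (u p') = ℓ),
            w (plaquetteHolonomy (update U ℓ v) p.1 p.2.1.1 p.2.1.2) ∂(haarProbability G))))⁻¹))^[n] μ).real A -
        π.real A| ≤ ε := by
  classical
  have hinj : Set.InjOn t B := injOn_of_ranked B t ht rank hrank
  have hw0 : ∀ g, 0 < w g := fun g => hm0.trans_le (hm g)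
  have h1 := (heatBath_worstCase_le_iff hd hL hw hm0 hm hM hw1 B t ht rank hrank π qB hπ hqB n ε).1 h
  refine (allClosing_worstCase_le_iff hd hL hw hm0 hm hM hwinv (B.image t)
    (fun ℓ => B.filter (fun b => t b = ℓ) ∪ (Finset.univ \ B).filter (fun p' => t (u p') = ℓ))
    (induced_nonempty B t u hinj huB) (induced_mem_links B t u ht hut) (induced_disjoint B t u)
    (induced_cover B t u huB) π q hπ hq n ε).2 ?_
  have hZ : 0 ≤ ∫ V, ∏ p : Plaquette d L, w (plaquetteHolonomy V p.1 p.2.1.1 p.2.1.2)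
      ∂(Measure.pi fun _ : Edge d L => haarProbability G) :=
    integral_nonneg fun V => prod_nonneg fun p _ => (hw0 _).le
  have hle := heatBath_coldRate_le_induced_allClosing hw hw0 hM B t hinj u huB hZ
  have hb := allClosing_uniform_rate hL hw hm0 hm hM hwinv (B.image t)
    (fun ℓ => B.filter (fun b => t b = ℓ) ∪ (Finset.univ \ B).filter (fun p' => t (u p') = ℓ))
    (induced_nonempty B t u hinj huB) (induced_mem_links B t u ht hut) (induced_disjoint B t u)
    (induced_cover B t u huB) π q hπ hq π 1 Set.univ
  rw [pow_one] at hb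
  have h0 := (abs_nonneg _).trans hb
  exact (pow_le_pow_left₀ h0 (by linarith) n).trans h1

/-- **STRICT MIXING DOMINANCE AT EVERY POSITIVE TIME.**  Under the hypotheses of
`allClosing_mixed_of_heatBath_mixed`, with `w` not constant (`w g₀ < M`) and some covered plaquette `a₀` closing at
least one uncovered plaquette: at every time `t ≥ 1` there is an `ε` (namely `(1 − Z/∏_{a∈B} c_{n_a+1})^t`) at
which every start and event of the all-closing sampler are `ε`-close to `π` but NOT every start and event of the
heat bath. [ours] -/
theorem exists_allClosing_mixed_heatBath_not [MeasurableSingletonClass G] [NullSingletonClass (haarProbability G)]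
    (hd : 0 < d) (hL : 2 ≤ L) {w : G → ℝ} (hw : Continuous w) {m M : ℝ} (hm0 : 0 < m)
    (hm : ∀ g, m ≤ w g) (hM : ∀ g, w g ≤ M) (hw1 : w 1 = M) (hwinv : ∀ g, w g⁻¹ = w g) {g₀ : G} (hg₀ : w g₀ < M)
    (B : Finset (Plaquette d L)) (t : Plaquette d L → Edge d L)
    (ht : ∀ p ∈ B, t p ∈ ({(p.1, p.2.1.1), (p.1.shift p.2.1.1, p.2.1.2),
        (p.1.shift p.2.1.2, p.2.1.1), (p.1, p.2.1.2)} : Finset (Edge d L)))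
    (rank : Plaquette d L → ℕ)
    (hrank : ∀ p ∈ B, ∀ p' ∈ B, p ≠ p' → t p ∈ ({(p'.1, p'.2.1.1), (p'.1.shift p'.2.1.1, p'.2.1.2),
        (p'.1.shift p'.2.1.2, p'.2.1.1), (p'.1, p'.2.1.2)} : Finset (Edge d L)) → rank p < rank p')
    (u : Plaquette d L → Plaquette d L) (huB : ∀ p' ∈ Finset.univ \ B, u p' ∈ B)
    (hut : ∀ p' ∈ Finset.univ \ B, t (u p') ∈ ({(p'.1, p'.2.1.1), (p'.1.shift p'.2.1.1, p'.2.1.2),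
        (p'.1.shift p'.2.1.2, p'.2.1.1), (p'.1, p'.2.1.2)} : Finset (Edge d L)))
    {a₀ : Plaquette d L} (ha₀ : a₀ ∈ B) (hn₀ : 1 ≤ ((Finset.univ \ B).filter (fun p' => u p' = a₀)).card)
    (π qB q : Measure (GaugeConfig d L G)) [IsProbabilityMeasure π] [IsProbabilityMeasure qB]
    [IsProbabilityMeasure q]
    (hπ : π = (Measure.pi fun _ : Edge d L => haarProbability G).withDensity fun U =>
      ENNReal.ofReal ((∏ p : Plaquette d L, w (plaquetteHolonomy U p.1 p.2.1.1 p.2.1.2)) /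
        ∫ V, ∏ p : Plaquette d L, w (plaquetteHolonomy V p.1 p.2.1.1 p.2.1.2) ∂(Measure.pi fun _ : Edge d L => haarProbability G)))
    (hqB : qB = (Measure.pi fun _ : Edge d L => haarProbability G).withDensity fun U =>
      ENNReal.ofReal ((∏ p ∈ B, w (plaquetteHolonomy U p.1 p.2.1.1 p.2.1.2)) /
        ∫ V, ∏ p ∈ B, w (plaquetteHolonomy V p.1 p.2.1.1 p.2.1.2) ∂(Measure.pi fun _ : Edge d L => haarProbability G)))
    (hq : q = (Measure.pi fun _ : Edge d L => haarProbability G).withDensity fun U =>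
      ENNReal.ofReal (∏ ℓ ∈ B.image t,
        (∏ p ∈ B.filter (fun b => t b = ℓ) ∪ (Finset.univ \ B).filter (fun p' => t (u p') = ℓ),
            w (plaquetteHolonomy U p.1 p.2.1.1 p.2.1.2)) /
          (∫ v, ∏ p ∈ B.filter (fun b => t b = ℓ) ∪ (Finset.univ \ B).filter (fun p' => t (u p') = ℓ),
            w (plaquetteHolonomy (update U ℓ v) p.1 p.2.1.1 p.2.1.2) ∂(haarProbability G))))
    {n : ℕ} (hn : n ≠ 0) :
    ∃ ε : ℝ,
      (∀ (μ : Measure (GaugeConfig d L G)) [IsProbabilityMeasure μ] (A : Set (GaugeConfig d L G)),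
        |((fun ν : Measure (GaugeConfig d L G) => ν.bind (indepMH q fun U =>
          (((∫ V, ∏ p : Plaquette d L, w (plaquetteHolonomy V p.1 p.2.1.1 p.2.1.2) ∂(Measure.pi fun _ : Edge d L => haarProbability G)) /
            ∏ ℓ ∈ B.image t, (∫ v, ∏ p ∈ B.filter (fun b => t b = ℓ) ∪ (Finset.univ \ B).filter (fun p' => t (u p') = ℓ),
              w (plaquetteHolonomy (update U ℓ v) p.1 p.2.1.1 p.2.1.2) ∂(haarProbability G))))⁻¹))^[n] μ).real A -
          π.real A| ≤ ε) ∧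
      ¬ (∀ (μ : Measure (GaugeConfig d L G)) [IsProbabilityMeasure μ] (A : Set (GaugeConfig d L G)),
        |((fun ν : Measure (GaugeConfig d L G) => ν.bind (indepMH qB fun U =>
          ((∫ V, ∏ p : Plaquette d L, w (plaquetteHolonomy V p.1 p.2.1.1 p.2.1.2)
              ∂(Measure.pi fun _ : Edge d L => haarProbability G)) /
            ((∫ V, ∏ p ∈ B, w (plaquetteHolonomy V p.1 p.2.1.1 p.2.1.2)
              ∂(Measure.pi fun _ : Edge d L => haarProbability G)) *
              ∏ p ∈ Finset.univ \ B, w (plaquetteHolonomy U p.1 p.2.1.1 p.2.1.2)))⁻¹))^[n] μ).real A -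
          π.real A| ≤ ε) := by
  classical
  have hinj : Set.InjOn t B := injOn_of_ranked B t ht rank hrank
  have hw0 : ∀ g, 0 < w g := fun g => hm0.trans_le (hm g)
  have hc : 0 < ∫ g, w g ∂(haarProbability G) := haarProbability_integral_pos_of_continuous_pos hw hw0
  refine ⟨(1 - (∫ V, ∏ p : Plaquette d L, w (plaquetteHolonomy V p.1 p.2.1.1 p.2.1.2)
      ∂(Measure.pi fun _ : Edge d L => haarProbability G)) /
    ∏ ℓ ∈ B.image t, ∫ h, w h ^ (B.filter (fun b => t b = ℓ) ∪
      (Finset.univ \ B).filter (fun p' => t (u p') = ℓ)).card ∂(haarProbability G)) ^ n, ?_, fun h => ?_⟩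
  · exact (allClosing_worstCase_le_iff hd hL hw hm0 hm hM hwinv (B.image t)
      (fun ℓ => B.filter (fun b => t b = ℓ) ∪ (Finset.univ \ B).filter (fun p' => t (u p') = ℓ))
      (induced_nonempty B t u hinj huB) (induced_mem_links B t u ht hut) (induced_disjoint B t u)
      (induced_cover B t u huB) π q hπ hq n _).2 le_rfl
  · have h1 := (heatBath_worstCase_le_iff hd hL hw hm0 hm hM hw1 B t ht rank hrank π qB hπ hqB n _).1 h
    have hZ : 0 < ∫ V, ∏ p : Plaquette d L, w (plaquetteHolonomy V p.1 p.2.1.1 p.2.1.2)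
        ∂(Measure.pi fun _ : Edge d L => haarProbability G) :=
      (mul_pos (pow_pos hm0 _) (pow_pos hc _)).trans_le (integral_prod_weight_bounds hL hw hm0 hm hM B t ht rank hrank).1
    have hlt := heatBath_coldRate_lt_induced_allClosing hw hw0 hM hg₀ B t hinj u huB ha₀ hn₀ hZ
    have hb := allClosing_uniform_rate hL hw hm0 hm hM hwinv (B.image t)
      (fun ℓ => B.filter (fun b => t b = ℓ) ∪ (Finset.univ \ B).filter (fun p' => t (u p') = ℓ))
      (induced_nonempty B t u hinj huB) (induced_mem_links B t u ht hut) (induced_disjoint B t u)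
      (induced_cover B t u huB) π q hπ hq π 1 Set.univ
    rw [pow_one] at hb
    have h0 := (abs_nonneg _).trans hb
    exact absurd h1 (not_le.2 (pow_lt_pow_left₀ (by linarith) h0 hn))

end Summit.Ventures.LatticeQCDFlow.Theory2.Autoregressive

end
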